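import Mathlib
import Literature.Probability.Percolation.PercolationProofs
import Literature.Probability.LatticeModels.ProdBernoulliIndependence
import Literature.Probability.LatticeModels.ProdBernoulliClusterLocality
import Literature.Probability.Percolation.KozmaNitzanPinning
import Summits.CriticalPhenomena.PercolationContinuityZ3.Theorems.PercNearOneGluingAdditiveGluingSigmaRecursion
import Summits.CriticalPhenomena.PercolationContinuityZ3.Theorems.PercNearOneGluingAdditiveGluingGoodBase
import Summits.CriticalPhenomena.PercolationContinuityZ3.Theorems.PercNearOneGluingAdditiveGluingLemma5AnyRelay
import Summits.CriticalPhenomena.PercolationContinuityZ3.Theorems.PercNearOneGluingAdditiveGluingGoodStepUniqueLowAux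
import HarnessLib

/-! # Crux `PercNearOneGluing.AdditiveGluing` (stmt-CriticalPhenomena-4576), line `subuniform-dead-pocket-maximum` —
# the inductive step `stub_goodStep` when the observer has a UNIQUE low neighbour (Kozma–Nitzan Theorem 5)

Helper file for the crux skeleton `Cruxes/AdditiveGluing/Lines/subuniform-dead-pocket-maximum.lean`
(siege on `stub_goodStep`, attempt k20).  Lands with `--supports stmt-CriticalPhenomena-4576`.
The toolkit (paths / fibre identities / independence / killed weighting / live–dead partition / fibre
bookkeeping) is the file `…GoodStepUniqueLowAux.lean`; the main theorem here is the registered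
partial-result stub `stub_goodStepUniqueLow`.

## Content

The registered stub `stub_goodStep` asks for Kozma–Nitzan GOODNESS (arXiv:2401.12397 §3.2 p. 12,
in the skeleton's linear selection form) of `(w, A, o, b)` whenever `o` has a low neighbour, given
goodness of every weight function with fewer positive-degree vertices.  This file proves the step
in the sub-case where the low neighbour is UNIQUE — every positive-weight pair `o–y` with
`y ∉ A` has `y = x` — which is exactly Kozma–Nitzan's **Theorem 5** (p. 13: "`(G ∖ {0}, A, x, b)`
good and `0` isolated in `G ∖ (A ∪ {x})` ⟹ `(G, A, 0, b)` good"), the first instance of the step: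

* `goodStep_uniqueLow_of_killed` — the step from goodness of `(w', A, x, b)` for ANY weighting `w'`
  that agrees with `w` off `o` and vanishes on every pair containing `o` ("`G ∖ {0}`");
* `stub_goodStepUniqueLow` — the registered signature of `stub_goodStep` with the two extra
  hypotheses "`x` is a low neighbour" and "every low neighbour is `x`", discharged from the previous
  theorem with `w' = (o ∈ ·) ? 0 : w` (which has fewer positive-degree vertices than `w`).

## Proof (KN pp. 13–14, in selection form; `μ = prodBernoulli w`, `μ' = prodBernoulli w'`,
`τ°(y) = μ(y ↔ b in {o}ᶜ) = μ'(y ↔ b)`, `σ_B` the open-star fibres at `o`, `a₀ = argmin_A τ°`)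

Partition `μ(a₀ ↔ b)` and `μ(o ↔ b)` by the open star `B` of `o`.  Fibres `B ∉ {∅, {x}}` either
meet `A` (KN Lemma 5, the landed `stub_lemma5AnyRelay`: `μ(σ_B, a₀ ↔ b) ≤ μ(σ_B, o ↔ b)`) or are
null (they contain a `y ∉ A ∪ {x}`, whose pair `o–y` has weight `0`).  The fibre `∅` gives
`μ(σ_∅) τ°(a₀)`, the fibre `{x}` gives `μ(σ_x) τ°(a₀)` against `μ(σ_x, o ↔ b) = μ(σ_x) τ°(x)`
(under `σ_x` every open path through `o` detours through `x`; disjoint-support independence).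
Goodness of `(w', A, x, b)` at level `1 − τ°(a₀)` with the selection `W' ↦ sel (insert o W')`
reads `τ°(x) ≥ τ°(a₀) − Σ_{W'} μ'(C(x) = W') · μ'(sel(insert o W') ↔ b in W'ᶜ)` (the live part
and the dead pockets of `x` partition the space), and each subtracted term, multiplied by
`μ(σ_x)`, is at most the `o`-pocket term of `insert o W'`: `μ'`-a.s. the star of `o` is closed, so
`{C(x) = W'}` is the event "`W'` = the vertices joined to `x` off `o`", which is determined off
`o`, independent of `σ_x`, and inside `σ_x` forces `C(o) = insert o W'`; and
`μ'(s ↔ b in W'ᶜ) ≤ μ(s ↔ b in (insert o W')ᶜ)`.  Summing (the map `W' ↦ insert o W'` is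
injective on `W' ∌ o`) and adding the live/dead partition at `o` gives the claim; the pocket
`{o}` is paid by `μ(σ_∅)(τ°(sel {o}) − τ°(a₀)) ≥ 0` exactly as in the base case.
No new definitions (the killed weighting enters as a variable with characterising hypotheses).
-/

namespace Summit.CriticalPhenomena.PercolationContinuityZ3.Theorems

namespace Summit.CriticalPhenomena.PercolationContinuityZ3.Theorems

open MeasureTheory Set
open Literature.Probability.LatticeModels (prodBernoulli)
open Literature.Probability.Percolation (BondConfig openConn openConnIn openGraph openCluster
  openGraph_adj DeterminedBy determinedBy_iff PathIn)
open Literature.Probability.Percolation.DCT16 (determinedBy_openConnIn pathIn_of_mem_openConnIn)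
open scoped BigOperators

noncomputable section
open Classical

variable {n : ℕ}

/-! ### The step for a unique low neighbour, from goodness of the killed weighting (KN Theorem 5) -/

/-- **KN Theorem 5, killed-weighting form.**  Let `b ∈ A`, `o ∉ A`, `x ≠ o`, and suppose
every pair `o–y` with `y ∉ A`, `y ≠ o`, `y ≠ x` has weight `0` (the low neighbour `x` of `o`, if any,
is unique).  Let `w'` agree with `w` on the pairs inside `{o}ᶜ` and vanish on every pair `o–y`,
`y ≠ o`.  If `(w', A, x, b)` is GOOD (in the skeleton's selection form, for every level and every
selection), then so is `(w, A, o, b)`.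
(Kozma–Nitzan arXiv:2401.12397, Theorem 5 p. 13, proof p. 14.) -/
theorem goodStep_uniqueLow_of_killed (w w' : Sym2 (Fin n) → unitInterval) (A : Finset (Fin n))
    (o b x : Fin n) (hbA : b ∈ A) (hoA : o ∉ A) (hxo : x ≠ o)
    (h1 : ∀ e ∈ (({o} : Set (Fin n))ᶜ).sym2, w e = w' e) (h2 : ∀ y : Fin n, y ≠ o → w' s(o, y) = 0)
    (huniq : ∀ y : Fin n, y ∉ A → y ≠ o → y ≠ x → w s(o, y) = 0)
    (hgood' : ∀ (t' : ℝ) (sel' : Finset (Fin n) → Fin n), (∀ W, sel' W ∈ A) →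
      (∀ a ∈ A, 1 - t' ≤ (prodBernoulli w').real (openConn a b)) →
      (prodBernoulli w').real ((⋃ a ∈ A, openConn x a) ∩ (openConn x b)ᶜ)
        + ∑ W ∈ (Finset.univ : Finset (Finset (Fin n))).filter (fun W => x ∈ W ∧ Disjoint W A),
            (prodBernoulli w').real {ω : BondConfig (Fin n) | openCluster ω x = (W : Set (Fin n))}
              * (prodBernoulli w').real (openConnIn ((W : Set (Fin n))ᶜ) (sel' W) b)ᶜ
        ≤ t')
    (t : ℝ) (sel : Finset (Fin n) → Fin n) (hsel : ∀ W, sel W ∈ A)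
    (hrel : ∀ a ∈ A, 1 - t ≤ (prodBernoulli w).real (openConn a b)) :
    (prodBernoulli w).real ((⋃ a ∈ A, openConn o a) ∩ (openConn o b)ᶜ)
      + ∑ W ∈ (Finset.univ : Finset (Finset (Fin n))).filter (fun W => o ∈ W ∧ Disjoint W A),
          (prodBernoulli w).real {ω : BondConfig (Fin n) | openCluster ω o = (W : Set (Fin n))}
            * (prodBernoulli w).real (openConnIn ((W : Set (Fin n))ᶜ) (sel W) b)ᶜ
      ≤ t := by
  have hbo : b ≠ o := fun h => hoA (h ▸ hbA)
  -- the minimiser `a₀` of `τ°` over `A`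
  obtain ⟨a₀, ha₀A, hmin⟩ := Finset.exists_min_image A
    (fun y => (prodBernoulli w).real (openConnIn (({o} : Set (Fin n))ᶜ) y b)) ⟨b, hbA⟩
  have ha₀o : a₀ ≠ o := fun h => hoA (h ▸ ha₀A)
  -- abbreviations
  set e := (prodBernoulli w).real {ω : BondConfig (Fin n) | ∀ y : Fin n, y ≠ o → s(o, y) ∉ ω} with he
  set s := (prodBernoulli w).real
    {ω : BondConfig (Fin n) | ∀ y : Fin n, y ≠ o → (s(o, y) ∈ ω ↔ y ∈ ({x} : Finset (Fin n)))} with hs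
  set τa := (prodBernoulli w).real (openConnIn (({o} : Set (Fin n))ᶜ) a₀ b) with hτa
  set τx := (prodBernoulli w).real (openConnIn (({o} : Set (Fin n))ᶜ) x b) with hτx
  set Q : Finset (Fin n) → ℝ := fun W =>
    (prodBernoulli w).real {ω : BondConfig (Fin n) | openCluster ω o = (W : Set (Fin n))}
      * (prodBernoulli w).real (openConnIn ((W : Set (Fin n))ᶜ) (sel W) b) with hQ
  have he0 : 0 ≤ e := measureReal_nonneg
  have hs0 : 0 ≤ s := measureReal_nonneg
  have hQ0 : ∀ W, 0 ≤ Q W := fun W => mul_nonneg measureReal_nonneg measureReal_nonneg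
  have hoxs : o ∉ ({x} : Finset (Fin n)) := fun h => hxo (Finset.mem_singleton.1 h).symm
  have hdet : ∀ y : Fin n, DeterminedBy (openConnIn (({o} : Set (Fin n))ᶜ) y b : Set (BondConfig (Fin n)))
      (↑(Finset.univ.filter fun e : Sym2 (Fin n) => o ∈ e) : Set (Sym2 (Fin n)))ᶜ := fun y =>
    determinedBy_openConnIn _ y b (goodStepU_sym2_compl_subset o)
  -- (F2) partition of `μ(a₀ ↔ b)` and `μ(o ↔ b)` by the open star of `o`
  have hF2 : (prodBernoulli w).real (openConn a₀ b) ≤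
      (prodBernoulli w).real (openConn o b) - s * τx + e * τa + s * τa := by
    have h1s := sigmaRec_sum_preimage_inter w
      (fun ω : BondConfig (Fin n) => Finset.univ.filter fun y : Fin n => y ≠ o ∧ s(o, y) ∈ ω)
      (openConn a₀ b)
    have h2s := sigmaRec_sum_preimage_inter w
      (fun ω : BondConfig (Fin n) => Finset.univ.filter fun y : Fin n => y ≠ o ∧ s(o, y) ∈ ω)
      (openConn o b)
    have g1e : (prodBernoulli w).real
        ((fun ω : BondConfig (Fin n) => Finset.univ.filter fun y : Fin n => y ≠ o ∧ s(o, y) ∈ ω) ⁻¹' {∅}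
          ∩ openConn a₀ b) = e * τa := by
      rw [goodBase_fibre_empty, goodBase_real_isolated_inter_openConn w o a₀ b ha₀o]
    have g1x : (prodBernoulli w).real
        ((fun ω : BondConfig (Fin n) => Finset.univ.filter fun y : Fin n => y ≠ o ∧ s(o, y) ∈ ω) ⁻¹' {{x}}
          ∩ openConn a₀ b) = s * τa := by
      rw [goodBase_fibre_eq o {x} hoxs, goodStepU_sigma_inter_openConn o x a₀ b ha₀o hbo,
        goodStepU_real_sigma_inter w o {x} (hdet a₀)]
    have g2x : (prodBernoulli w).real
        ((fun ω : BondConfig (Fin n) => Finset.univ.filter fun y : Fin n => y ≠ o ∧ s(o, y) ∈ ω) ⁻¹' {{x}}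
          ∩ openConn o b) = s * τx := by
      rw [goodBase_fibre_eq o {x} hoxs, goodStepU_sigma_inter_openConn_self o x b hxo hbo,
        goodStepU_real_sigma_inter w o {x} (hdet x)]
    have hle := goodStepU_sum_le
      (fun B => (prodBernoulli w).real
        ((fun ω : BondConfig (Fin n) => Finset.univ.filter fun y : Fin n => y ≠ o ∧ s(o, y) ∈ ω) ⁻¹' {B}
          ∩ openConn a₀ b))
      (fun B => (prodBernoulli w).real
        ((fun ω : BondConfig (Fin n) => Finset.univ.filter fun y : Fin n => y ≠ o ∧ s(o, y) ∈ ω) ⁻¹' {B}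
          ∩ openConn o b))
      x measureReal_nonneg
      fun B hB hBx => goodStepU_term_le w A B o b x a₀ hbo ha₀o hmin huniq hB hBx
    rw [h1s, h2s, g1e, g1x, g2x] at hle
    linarith
  -- (F3) goodness of `(w', A, x, b)` at level `1 - τa`, selection `W' ↦ sel (insert o W')`
  have hF3 : s * τa ≤ s * τx +
      ∑ W ∈ ((Finset.univ : Finset (Finset (Fin n))).filter (fun W => o ∈ W ∧ Disjoint W A)).erase {o},
        Q W := by
    have hIH := hgood' (1 - τa) (fun W' => sel (insert o W')) (fun W' => hsel _) fun a haA => by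
      have hao : a ≠ o := fun h => hoA (h ▸ haA)
      rw [← lemma5AnyRelay_real_openConnIn_compl_eq w w' o a b hao h1 h2]
      have := hmin a haA
      linarith
    -- rewrite the live part and the penalty of the killed weighting
    have hsub' : (openConn x b : Set (BondConfig (Fin n))) ⊆ ⋃ a ∈ A, openConn x a := fun ω hω =>
      Set.mem_iUnion₂.2 ⟨b, hbA, hω⟩
    have hlive' : (prodBernoulli w').real ((⋃ a ∈ A, openConn x a) ∩ (openConn x b)ᶜ) =
        (prodBernoulli w').real (⋃ a ∈ A, (openConn x a : Set (BondConfig (Fin n)))) -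
          (prodBernoulli w').real (openConn x b) := by
      rw [← Set.sdiff_eq, measureReal_sdiff hsub' (Set.toFinite _).measurableSet (measure_ne_top _ _)]
    have hpen' : ∑ W ∈ (Finset.univ : Finset (Finset (Fin n))).filter (fun W => x ∈ W ∧ Disjoint W A),
        (prodBernoulli w').real {ω : BondConfig (Fin n) | openCluster ω x = (W : Set (Fin n))}
          * (prodBernoulli w').real (openConnIn ((W : Set (Fin n))ᶜ) (sel (insert o W)) b)ᶜ =
        ∑ W ∈ (Finset.univ : Finset (Finset (Fin n))).filter (fun W => x ∈ W ∧ Disjoint W A),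
          (prodBernoulli w').real {ω : BondConfig (Fin n) | openCluster ω x = (W : Set (Fin n))} -
        ∑ W ∈ (Finset.univ : Finset (Finset (Fin n))).filter (fun W => x ∈ W ∧ Disjoint W A),
          (prodBernoulli w').real {ω : BondConfig (Fin n) | openCluster ω x = (W : Set (Fin n))}
            * (prodBernoulli w').real (openConnIn ((W : Set (Fin n))ᶜ) (sel (insert o W)) b) := by
      rw [← Finset.sum_sub_distrib]
      refine Finset.sum_congr rfl fun W _ => ?_
      rw [probReal_compl_eq_one_sub (Set.toFinite _).measurableSet]
      ring
    have hpart' := stub_goodStepLiveDeadPartition n w' A x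
    have hτx' : (prodBernoulli w').real (openConn x b) = τx :=
      (lemma5AnyRelay_real_openConnIn_compl_eq w w' o x b hxo h1 h2).symm
    rw [hlive', hpen', hτx'] at hIH
    -- so `τa ≤ τx + Σ_{W'} q W'`; multiply by `s` and bound each term
    have hIH' : τa ≤ τx +
        ∑ W ∈ (Finset.univ : Finset (Finset (Fin n))).filter (fun W => x ∈ W ∧ Disjoint W A),
          (prodBernoulli w').real {ω : BondConfig (Fin n) | openCluster ω x = (W : Set (Fin n))}
            * (prodBernoulli w').real (openConnIn ((W : Set (Fin n))ᶜ) (sel (insert o W)) b) := by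
      linarith
    have hterm : ∀ W' ∈ (Finset.univ : Finset (Finset (Fin n))).filter (fun W => x ∈ W ∧ Disjoint W A),
        s * ((prodBernoulli w').real {ω : BondConfig (Fin n) | openCluster ω x = (W' : Set (Fin n))}
            * (prodBernoulli w').real (openConnIn ((W' : Set (Fin n))ᶜ) (sel (insert o W')) b)) ≤
          if o ∉ W' then Q (insert o W') else 0 := by
      intro W' _
      have hcl := goodStepU_real_cluster_le_offCluster w w' o x hxo h1 h2 W'
      split_ifs with hoW'
      · -- `o ∈ W'`: a null pocket of `x` under `w'`
        have hF0 : {ω : BondConfig (Fin n) | ∀ y : Fin n,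
            y ∈ W' ↔ ω ∈ openConnIn (({o} : Set (Fin n))ᶜ) x y} = ∅ := by
          ext ω
          simp only [Set.mem_setOf_eq, Set.mem_empty_iff_false, iff_false]
          intro h
          have ho := (h o).1 hoW'
          exact (pathIn_of_mem_openConnIn ho).right_mem rfl
        rw [hF0, measureReal_empty] at hcl
        have h0 : (prodBernoulli w').real {ω : BondConfig (Fin n) | openCluster ω x = (W' : Set (Fin n))} = 0 :=
          le_antisymm hcl measureReal_nonneg
        rw [h0, zero_mul, mul_zero]
      · -- `o ∉ W'`: the `o`-pocket `insert o W'`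
        have hsF : s * (prodBernoulli w').real
            {ω : BondConfig (Fin n) | openCluster ω x = (W' : Set (Fin n))} ≤
            (prodBernoulli w).real
              {ω : BondConfig (Fin n) | openCluster ω o = ((insert o W' : Finset (Fin n)) : Set (Fin n))} := by
          calc s * (prodBernoulli w').real {ω : BondConfig (Fin n) | openCluster ω x = (W' : Set (Fin n))}
              ≤ s * (prodBernoulli w).real
                  {ω : BondConfig (Fin n) | ∀ y : Fin n,
                    y ∈ W' ↔ ω ∈ openConnIn (({o} : Set (Fin n))ᶜ) x y} :=
                mul_le_mul_of_nonneg_left hcl hs0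
            _ = (prodBernoulli w).real
                  ({ω : BondConfig (Fin n) | ∀ y : Fin n, y ≠ o → (s(o, y) ∈ ω ↔ y ∈ ({x} : Finset (Fin n)))}
                    ∩ {ω : BondConfig (Fin n) | ∀ y : Fin n,
                      y ∈ W' ↔ ω ∈ openConnIn (({o} : Set (Fin n))ᶜ) x y}) :=
                (goodStepU_real_sigma_inter w o {x}
                  (goodStepU_determinedBy_offCluster o x W' (goodStepU_sym2_compl_subset o))).symm
            _ ≤ _ := measureReal_mono (goodStepU_sigma_inter_offCluster_subset o x hxo W')
        have hoc : (prodBernoulli w').real (openConnIn ((W' : Set (Fin n))ᶜ) (sel (insert o W')) b) ≤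
            (prodBernoulli w).real
              (openConnIn (((insert o W' : Finset (Fin n)) : Set (Fin n))ᶜ) (sel (insert o W')) b) := by
          rw [goodStepU_coe_insert_compl]
          exact goodStepU_real_openConnIn_le w w' o (sel (insert o W')) b
            (fun h => hoA (h ▸ hsel _)) h1 h2 W'
        calc s * ((prodBernoulli w').real {ω : BondConfig (Fin n) | openCluster ω x = (W' : Set (Fin n))}
              * (prodBernoulli w').real (openConnIn ((W' : Set (Fin n))ᶜ) (sel (insert o W')) b))
            = (s * (prodBernoulli w').real {ω : BondConfig (Fin n) | openCluster ω x = (W' : Set (Fin n))})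
                * (prodBernoulli w').real (openConnIn ((W' : Set (Fin n))ᶜ) (sel (insert o W')) b) := by
              ring
          _ ≤ (prodBernoulli w).real
                {ω : BondConfig (Fin n) | openCluster ω o = ((insert o W' : Finset (Fin n)) : Set (Fin n))} *
              (prodBernoulli w).real
                (openConnIn (((insert o W' : Finset (Fin n)) : Set (Fin n))ᶜ) (sel (insert o W')) b) :=
              mul_le_mul hsF hoc measureReal_nonneg measureReal_nonneg
          _ = Q (insert o W') := rfl
    have hsum1 : s * ∑ W ∈ (Finset.univ : Finset (Finset (Fin n))).filter (fun W => x ∈ W ∧ Disjoint W A),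
          (prodBernoulli w').real {ω : BondConfig (Fin n) | openCluster ω x = (W : Set (Fin n))}
            * (prodBernoulli w').real (openConnIn ((W : Set (Fin n))ᶜ) (sel (insert o W)) b) ≤
        ∑ W ∈ (Finset.univ : Finset (Finset (Fin n))).filter (fun W => x ∈ W ∧ Disjoint W A),
          (if o ∉ W then Q (insert o W) else 0) := by
      rw [Finset.mul_sum]
      exact Finset.sum_le_sum hterm
    -- re-index the bounds by `W' ↦ insert o W'` (injective on `W' ∌ o`) into the `o`-pockets `≠ {o}`
    have hsum2 : ∑ W ∈ (Finset.univ : Finset (Finset (Fin n))).filter (fun W => x ∈ W ∧ Disjoint W A),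
          (if o ∉ W then Q (insert o W) else 0) ≤
        ∑ W ∈ ((Finset.univ : Finset (Finset (Fin n))).filter (fun W => o ∈ W ∧ Disjoint W A)).erase {o},
          Q W := by
      rw [← Finset.sum_filter]
      have hinj : Set.InjOn (fun W : Finset (Fin n) => insert o W)
          ↑(((Finset.univ : Finset (Finset (Fin n))).filter (fun W => x ∈ W ∧ Disjoint W A)).filter
            (fun W => o ∉ W)) := by
        intro W₁ hW₁ W₂ hW₂ h
        have h₁ : o ∉ W₁ := (Finset.mem_filter.1 (Finset.mem_coe.1 hW₁)).2
        have h₂ : o ∉ W₂ := (Finset.mem_filter.1 (Finset.mem_coe.1 hW₂)).2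
        have := congrArg (fun W : Finset (Fin n) => W.erase o) h
        simpa only [Finset.erase_insert h₁, Finset.erase_insert h₂] using this
      rw [← Finset.sum_image hinj]
      refine Finset.sum_le_sum_of_subset_of_nonneg ?_ fun W _ _ => hQ0 W
      intro W hW
      obtain ⟨W', hW', rfl⟩ := Finset.mem_image.1 hW
      rw [Finset.mem_filter, Finset.mem_filter] at hW'
      obtain ⟨⟨-, hxW', hW'A⟩, hoW'⟩ := hW'
      refine Finset.mem_erase.2 ⟨fun h => ?_, Finset.mem_filter.2 ⟨Finset.mem_univ _,
        Finset.mem_insert_self o W', Finset.disjoint_insert_left.2 ⟨hoA, hW'A⟩⟩⟩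
      have hx' : x ∈ ({o} : Finset (Fin n)) := h ▸ Finset.mem_insert_of_mem hxW'
      exact hxo (Finset.mem_singleton.1 hx')
    have := mul_le_mul_of_nonneg_left hIH' hs0
    rw [mul_add] at this
    linarith
  -- (F4) the pocket `{o}`
  have hCe : (prodBernoulli w).real
      {ω : BondConfig (Fin n) | openCluster ω o = ((({o} : Finset (Fin n))) : Set (Fin n))} = e :=
    le_antisymm (measureReal_mono (goodBase_cluster_singleton_subset o))
      (measureReal_mono (goodStepU_isolated_subset_cluster_singleton o))
  have hF4 : e * τa ≤ Q {o} := by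
    simp only [hQ]
    rw [hCe, Finset.coe_singleton]
    exact mul_le_mul_of_nonneg_left (hmin (sel {o}) (hsel {o})) he0
  -- (F1) rewrite the goal: live part, penalty, partition at `o`, the pocket `{o}` split off
  have hsub : (openConn o b : Set (BondConfig (Fin n))) ⊆ ⋃ a ∈ A, openConn o a := fun ω hω =>
    Set.mem_iUnion₂.2 ⟨b, hbA, hω⟩
  have hlive : (prodBernoulli w).real ((⋃ a ∈ A, openConn o a) ∩ (openConn o b)ᶜ) =
      (prodBernoulli w).real (⋃ a ∈ A, (openConn o a : Set (BondConfig (Fin n)))) -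
        (prodBernoulli w).real (openConn o b) := by
    rw [← Set.sdiff_eq, measureReal_sdiff hsub (Set.toFinite _).measurableSet (measure_ne_top _ _)]
  have hpen : ∑ W ∈ (Finset.univ : Finset (Finset (Fin n))).filter (fun W => o ∈ W ∧ Disjoint W A),
      (prodBernoulli w).real {ω : BondConfig (Fin n) | openCluster ω o = (W : Set (Fin n))}
        * (prodBernoulli w).real (openConnIn ((W : Set (Fin n))ᶜ) (sel W) b)ᶜ =
      ∑ W ∈ (Finset.univ : Finset (Finset (Fin n))).filter (fun W => o ∈ W ∧ Disjoint W A),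
        (prodBernoulli w).real {ω : BondConfig (Fin n) | openCluster ω o = (W : Set (Fin n))} -
      ∑ W ∈ (Finset.univ : Finset (Finset (Fin n))).filter (fun W => o ∈ W ∧ Disjoint W A), Q W := by
    rw [← Finset.sum_sub_distrib]
    refine Finset.sum_congr rfl fun W _ => ?_
    rw [probReal_compl_eq_one_sub (Set.toFinite _).measurableSet]
    simp only [hQ]
    ring
  have hpart := stub_goodStepLiveDeadPartition n w A o
  have hmem : ({o} : Finset (Fin n)) ∈
      (Finset.univ : Finset (Finset (Fin n))).filter (fun W => o ∈ W ∧ Disjoint W A) :=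
    Finset.mem_filter.2 ⟨Finset.mem_univ _, Finset.mem_singleton_self o,
      Finset.disjoint_singleton_left.2 hoA⟩
  have hsplit := Finset.add_sum_erase _ Q hmem
  have hrel₀ := hrel a₀ ha₀A
  rw [hlive, hpen]
  linarith


/-- **The inductive step `stub_goodStep` for an observer with a UNIQUE low neighbour** (Kozma–Nitzan
arXiv:2401.12397, Theorem 5 p. 13, in the registered vocabulary of the crux skeleton
`subuniform-dead-pocket-maximum`).  The hypotheses are VERBATIM those of `stub_goodStep` — `b ∈ A`,
`o ∉ A`, a low neighbour exists, and goodness of every weight function on `Fin n` with fewer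
positive-degree vertices — plus two more: a vertex `x ∉ A`, and "every low neighbour of `o` is `x`"
(`y ∉ A`, `y ≠ o`, `w(o–y) ≠ 0 ⟹ y = x`).  Conclusion: `GOOD(w, A, o, b)` in selection form.
Proof: `goodStep_uniqueLow_of_killed` with the killed weighting `w' = (o ∈ ·) ? 0 : w`, whose set of
positive-degree vertices is that of `w` minus `o` (so the induction hypothesis applies to
`(w', A, x, b)`).  This is the first instance of the step; the general step (several low
neighbours) is the open part of the stub. -/
theorem stub_goodStepUniqueLow :
    ∀ (n : ℕ) (w : Sym2 (Fin n) → unitInterval) (A : Finset (Fin n)) (o b : Fin n),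
      b ∈ A → o ∉ A →
      (∃ y : Fin n, y ∉ A ∧ y ≠ o ∧ (w s(o, y) : ℝ) ≠ 0) →
      (∀ w' : Sym2 (Fin n) → unitInterval,
        (Finset.univ.filter (fun v : Fin n => ∃ u : Fin n, 0 < (w' s(u, v) : ℝ))).card
          < (Finset.univ.filter (fun v : Fin n => ∃ u : Fin n, 0 < (w s(u, v) : ℝ))).card →
        ∀ (A' : Finset (Fin n)) (o' b' : Fin n), b' ∈ A' → o' ∉ A' →
        ∀ (t : ℝ) (sel : Finset (Fin n) → Fin n), (∀ W, sel W ∈ A') →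
          (∀ a ∈ A', 1 - t ≤ (prodBernoulli w').real (openConn a b')) →
          (prodBernoulli w').real ((⋃ a ∈ A', openConn o' a) ∩ (openConn o' b')ᶜ)
            + ∑ W ∈ (Finset.univ : Finset (Finset (Fin n))).filter (fun W => o' ∈ W ∧ Disjoint W A'),
                (prodBernoulli w').real {ω : BondConfig (Fin n) | openCluster ω o' = (W : Set (Fin n))}
                  * (prodBernoulli w').real (openConnIn ((W : Set (Fin n))ᶜ) (sel W) b')ᶜ
            ≤ t) →
      ∀ x : Fin n, x ∉ A → (∀ y : Fin n, y ∉ A → y ≠ o → (w s(o, y) : ℝ) ≠ 0 → y = x) →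
      ∀ (t : ℝ) (sel : Finset (Fin n) → Fin n), (∀ W, sel W ∈ A) →
        (∀ a ∈ A, 1 - t ≤ (prodBernoulli w).real (openConn a b)) →
        (prodBernoulli w).real ((⋃ a ∈ A, openConn o a) ∩ (openConn o b)ᶜ)
          + ∑ W ∈ (Finset.univ : Finset (Finset (Fin n))).filter (fun W => o ∈ W ∧ Disjoint W A),
              (prodBernoulli w).real {ω : BondConfig (Fin n) | openCluster ω o = (W : Set (Fin n))}
                * (prodBernoulli w).real (openConnIn ((W : Set (Fin n))ᶜ) (sel W) b)ᶜ
          ≤ t := by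
  intro n w A o b hbA hoA hlow hIH x hxA huniq t sel hsel hrel
  obtain ⟨y₀, hy₀A, hy₀o, hy₀w⟩ := hlow
  obtain rfl : y₀ = x := huniq y₀ hy₀A hy₀o hy₀w
  -- the killed weighting
  obtain ⟨w', hw'⟩ : ∃ w' : Sym2 (Fin n) → unitInterval, w' = fun e => if o ∈ e then 0 else w e :=
    ⟨_, rfl⟩
  have h1 : ∀ e ∈ (({o} : Set (Fin n))ᶜ).sym2, w e = w' e := by
    intro e he
    have hoe : o ∉ e := fun h => Set.mem_sym2_iff_subset.1 he h rfl
    rw [hw']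
    dsimp only
    rw [if_neg hoe]
  have h2 : ∀ y : Fin n, y ≠ o → w' s(o, y) = 0 := fun y _ => by
    rw [hw']
    dsimp only
    rw [if_pos (Sym2.mem_mk_left o y)]
  have huniq' : ∀ y : Fin n, y ∉ A → y ≠ o → y ≠ y₀ → w s(o, y) = 0 := by
    intro y hyA hyo hyx
    by_contra h
    exact hyx (huniq y hyA hyo fun h' => h (Set.Icc.coe_eq_zero.1 h'))
  -- `w'` has fewer positive-degree vertices: those of `w` minus `o`
  have hcard : (Finset.univ.filter (fun v : Fin n => ∃ u : Fin n, 0 < (w' s(u, v) : ℝ))).card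
      < (Finset.univ.filter (fun v : Fin n => ∃ u : Fin n, 0 < (w s(u, v) : ℝ))).card := by
    refine Finset.card_lt_card ((Finset.ssubset_iff_of_subset ?_).2 ⟨o, ?_, ?_⟩)
    · intro v hv
      rw [Finset.mem_filter] at hv ⊢
      obtain ⟨-, u, hu⟩ := hv
      refine ⟨Finset.mem_univ _, u, ?_⟩
      rw [hw'] at hu
      dsimp only at hu
      split_ifs at hu with h
      · exact absurd hu (lt_irrefl _)
      · exact hu
    · rw [Finset.mem_filter]
      refine ⟨Finset.mem_univ _, y₀, ?_⟩
      rw [Sym2.eq_swap]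
      exact lt_of_le_of_ne (w s(o, y₀)).2.1 (Ne.symm hy₀w)
    · rw [Finset.mem_filter]
      rintro ⟨-, u, hu⟩
      rw [hw'] at hu
      dsimp only at hu
      rw [if_pos (Sym2.mem_mk_right u o)] at hu
      exact lt_irrefl _ hu
  exact goodStep_uniqueLow_of_killed w w' A o b y₀ hbA hoA hy₀o h1 h2 huniq'
    (hIH w' hcard A y₀ b hbA hxA) t sel hsel hrel

end

end Summit.CriticalPhenomena.PercolationContinuityZ3.Theorems
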